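import Mathlib.NumberTheory.NumberField.InfinitePlace.Embeddings
import Mathlib.Analysis.Complex.Polynomial.Basic
import HarnessLib

/-!
# A uniform Northcott count: integers of bounded house in a number field of degree `n`

Topic `Literature/NumberTheory/NumberFields`, namespace `Literature.NumberTheory.NumberFields`.
Everything here is PROVED (theorems only, no definitions).

Mathlib's `NumberField.Embeddings.finite_of_norm_le` says that the algebraic integers `x` of a
number field `K` all of whose conjugates satisfy `‖φ x‖ ≤ B` form a finite set.  We make the
count UNIFORM in the field: its size is at most `n · (2C + 1)^{n+1}` with
`C = ⌈max(B,1)^n · binom(n, ⌊n/2⌋)⌉`, a function of the degree `n = [K : ℚ]` and of `B` alone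
(Northcott's theorem in its crudest quantitative form: such an `x` is a root of an integer
polynomial of degree `≤ n` whose coefficients are bounded by `C`
(`NumberField.Embeddings.coeff_bdd_of_norm_le`), there are `(2C+1)^{n+1}` coefficient vectors, and
each polynomial has at most `n` roots in `K`), and the existential packaging
`exists_ncard_integers_norm_le_of_finrank_le` (one bound for all fields of degree `≤ n`).

This is the counting input of the Kronecker-type height gap for units and of the regulator /
residue lower bounds of this directory (`UnitHeightGap.lean`, `RegulatorLowerBound.lean`).
Design: no named constants are introduced (the consumers only need SOME bound depending on `n`).

## References
* D. G. Northcott, *An inequality in the theory of arithmetic on algebraic varieties*,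
  Proc. Cambridge Philos. Soc. 45 (1949) 502–509 (finiteness of points of bounded height and degree). [Northcott1949]
* Mathlib, `Mathlib/NumberTheory/NumberField/InfinitePlace/Embeddings.lean` (`finite_of_norm_le`).
-/

open Polynomial Module

namespace Literature.NumberTheory.NumberFields

variable (K : Type*) [Field K] [NumberField K]
variable (A : Type*) [NormedField A] [IsAlgClosed A] [NormedAlgebra ℚ A]

/-- **Uniform Northcott count.** In a number field `K` of degree `n`, the set of algebraic
integers `x` with `‖φ x‖ ≤ B` for every embedding `φ : K → A` (`A` an algebraically closed normed
field, e.g. `ℂ`) has at most `n · (2C+1)^{n+1}` elements, `C = ⌈max(B,1)^n · binom(n,⌊n/2⌋)⌉`.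
[cite: Northcott1949, Thm. 1 (finiteness; crude count)] -/
theorem ncard_integers_norm_le (B : ℝ) :
    {x : K | IsIntegral ℤ x ∧ ∀ φ : K →+* A, ‖φ x‖ ≤ B}.ncard ≤
      finrank ℚ K * (2 * ⌈max B 1 ^ finrank ℚ K * ((finrank ℚ K).choose (finrank ℚ K / 2) : ℝ)⌉₊ + 1) ^
        (finrank ℚ K + 1) := by
  classical
  set n : ℕ := finrank ℚ K with hn
  set Cb : ℕ := ⌈max B 1 ^ n * (n.choose (n / 2) : ℝ)⌉₊ with hCb
  -- polynomials from coefficient vectors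
  let P : (Fin (n + 1) → ℤ) → ℤ[X] := fun v => ∑ i : Fin (n + 1), C (v i) * X ^ (i : ℕ)
  have hPdeg : ∀ v, (P v).natDegree ≤ n := fun v => by
    refine natDegree_sum_le_of_forall_le _ _ fun i _ => ?_
    calc (C (v i) * X ^ (i : ℕ)).natDegree ≤ (i : ℕ) := natDegree_C_mul_X_pow_le _ _
      _ ≤ n := Nat.lt_succ_iff.mp i.isLt
  have hPcoeff : ∀ p : ℤ[X], p.natDegree ≤ n → P (fun i : Fin (n + 1) => p.coeff i) = p := by
    intro p hp
    simp only [P]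
    conv_rhs => rw [p.as_sum_range_C_mul_X_pow' (Nat.lt_succ_of_le hp)]
    rw [Finset.sum_range]
  -- the finite set of coefficient vectors and the finite set of all their roots in `K`
  let V : Finset (Fin (n + 1) → ℤ) := Fintype.piFinset fun _ => Finset.Icc (-(Cb : ℤ)) Cb
  let R : (Fin (n + 1) → ℤ) → Finset K := fun v => ((P v).map (algebraMap ℤ K)).roots.toFinset
  let S : Finset K := V.biUnion R
  have hV : V.card = (2 * Cb + 1) ^ (n + 1) := by
    rw [Fintype.card_piFinset, Finset.prod_const, Finset.card_univ, Fintype.card_fin, Int.card_Icc]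
    congr 1
    omega
  have hR : ∀ v, (R v).card ≤ n := fun v =>
    calc (R v).card ≤ ((P v).map (algebraMap ℤ K)).roots.card := Multiset.toFinset_card_le _
      _ ≤ ((P v).map (algebraMap ℤ K)).natDegree := card_roots' _
      _ ≤ (P v).natDegree := natDegree_map_le
      _ ≤ n := hPdeg v
  have hS : S.card ≤ n * (2 * Cb + 1) ^ (n + 1) := by
    calc S.card ≤ ∑ v ∈ V, (R v).card := Finset.card_biUnion_le
      _ ≤ ∑ _v ∈ V, n := Finset.sum_le_sum fun v _ => hR v
      _ = n * (2 * Cb + 1) ^ (n + 1) := by rw [Finset.sum_const, hV, smul_eq_mul, mul_comm]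
  -- the set is contained in `S`
  have hsub : {x : K | IsIntegral ℤ x ∧ ∀ φ : K →+* A, ‖φ x‖ ≤ B} ⊆ (S : Set K) := by
    rintro x ⟨hx, hB⟩
    have h_map := minpoly.isIntegrallyClosed_eq_field_fractions' ℚ hx
    have hdeg : (minpoly ℤ x).natDegree ≤ n := by
      rw [← (minpoly.monic hx).natDegree_map (algebraMap ℤ ℚ), ← h_map]
      exact minpoly.natDegree_le x
    have hcoeff : ∀ i : ℕ, (minpoly ℤ x).coeff i ∈ Finset.Icc (-(Cb : ℤ)) Cb := by
      intro i
      rw [Finset.mem_Icc, ← abs_le, ← @Int.cast_le ℝ]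
      refine (Eq.trans_le ?_ <| NumberField.Embeddings.coeff_bdd_of_norm_le hB i).trans (Nat.le_ceil _)
      rw [h_map, coeff_map, eq_intCast, Int.norm_cast_rat, Int.norm_eq_abs, Int.cast_abs]
    simp only [Finset.coe_biUnion, Finset.mem_coe, Set.mem_iUnion, S]
    refine ⟨fun i => (minpoly ℤ x).coeff i, ?_, ?_⟩
    · exact Fintype.mem_piFinset.mpr fun i => hcoeff i
    · simp only [R, Multiset.mem_toFinset]
      rw [hPcoeff _ hdeg, mem_roots ((minpoly.monic hx).map _).ne_zero, IsRoot.def,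
        eval_map, ← aeval_def]
      exact minpoly.aeval ℤ x
  calc {x : K | IsIntegral ℤ x ∧ ∀ φ : K →+* A, ‖φ x‖ ≤ B}.ncard ≤ (S : Set K).ncard :=
        Set.ncard_le_ncard hsub S.finite_toSet
    _ = S.card := Set.ncard_coe_finset S
    _ ≤ n * (2 * Cb + 1) ^ (n + 1) := hS

/-- **Uniform Northcott count, existential form.** For every `n` and `B` there is ONE natural
number `M` such that every number field `K` with `[K:ℚ] ≤ n` has at most `M` algebraic integers all
of whose complex conjugates have absolute value `≤ B`.
[cite: Northcott1949, Thm. 1 (finiteness; crude count)] -/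
theorem exists_ncard_integers_norm_le_of_finrank_le (n : ℕ) (B : ℝ) :
    ∃ M : ℕ, ∀ (K : Type) [Field K] [NumberField K], finrank ℚ K ≤ n →
      {x : K | IsIntegral ℤ x ∧ ∀ φ : K →+* ℂ, ‖φ x‖ ≤ B}.ncard ≤ M := by
  -- a bound monotone in the degree: `n · (2 ⌈max(B,1)^n 2^n⌉ + 1)^{n+1}`
  refine ⟨n * (2 * ⌈max B 1 ^ n * (2 : ℝ) ^ n⌉₊ + 1) ^ (n + 1), fun K _ _ hK => ?_⟩
  have h := ncard_integers_norm_le K ℂ B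
  set m : ℕ := finrank ℚ K with hm
  have hB1 : (1 : ℝ) ≤ max B 1 := le_max_right _ _
  have hchoose : (m.choose (m / 2) : ℝ) ≤ (2 : ℝ) ^ m := by
    exact_mod_cast (Nat.choose_le_two_pow _ _)
  have hceil : ⌈max B 1 ^ m * (m.choose (m / 2) : ℝ)⌉₊ ≤ ⌈max B 1 ^ n * (2 : ℝ) ^ n⌉₊ := by
    apply Nat.ceil_mono
    calc max B 1 ^ m * (m.choose (m / 2) : ℝ) ≤ max B 1 ^ m * (2 : ℝ) ^ m := by
          gcongr
      _ ≤ max B 1 ^ n * (2 : ℝ) ^ n :=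
          mul_le_mul (pow_le_pow_right₀ hB1 hK) (pow_le_pow_right₀ (by norm_num) hK)
            (by positivity) (by positivity)
  have hm_le : m * (2 * ⌈max B 1 ^ m * (m.choose (m / 2) : ℝ)⌉₊ + 1) ^ (m + 1) ≤
      n * (2 * ⌈max B 1 ^ n * (2 : ℝ) ^ n⌉₊ + 1) ^ (n + 1) := by
    apply Nat.mul_le_mul hK
    calc (2 * ⌈max B 1 ^ m * (m.choose (m / 2) : ℝ)⌉₊ + 1) ^ (m + 1)
          ≤ (2 * ⌈max B 1 ^ n * (2 : ℝ) ^ n⌉₊ + 1) ^ (m + 1) := by gcongr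
      _ ≤ (2 * ⌈max B 1 ^ n * (2 : ℝ) ^ n⌉₊ + 1) ^ (n + 1) :=
            Nat.pow_le_pow_right (by omega) (by omega)
  exact h.trans hm_le

end Literature.NumberTheory.NumberFields
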